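import Summits.AtomisticToContinuum.FouriersLaw.Theorems.EmbeddedDrudeMourreAbelThermodynamicLimitAnchoredCorrelationTails
import Literature.MathematicalPhysics.KineticTheory.InfiniteChainObservables
import Literature.MathematicalPhysics.KineticTheory.InfiniteChainSevered

/-!
# Leaf (B₀) `stub_fixedTimeOffsetMatching` of S4, glue part 2: the centred embedding, the product form of the
open-chain pair correlation, and the locality of the severed flow
(crux `EmbeddedDrudeMourre.AbelThermodynamicLimit`, item stmt-AtomisticToContinuum-12596, line
`loomis-compact-horizon-witness`; `--supports` file proving the registered sub-goal `stub_pairCorrProductForm`;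
closes nothing)

* §1 the CENTRED EMBEDDING `ι_N : PhaseSpace N → ChainConfig` (site `k` of the chain sits at `k - c_N`,
  `c_N = ⌊(N-1)/2⌋`, zero off the chain), entered through its defining equation (no definition is posited):
  continuity, measurability, and `j_k = j_{k - c_N} ∘ ι_N` for genuine bonds (`bondCurrent` vs `bondCurrentZ`);
* §2 STATIONARITY OF THE PATH LAW in measure-preserving form — `(z, ω) ↦ Φ_t(z, Bω)` pushes `μ_{N,T} ⊗ W` to `μ_{N,T}`
  at every real time (Gibbs invariance of the constructed kernels, `pinnedChain_lintegral_prod_solMap_gibbs`) — and the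
  PRODUCT FORM of the equilibrium pair correlation,
  `∫ j_c · (κ_t j_k) dμ_{N,T} = ∫ j_c(z) j_k(Φ_t(z, Bω)) d(μ_{N,T} ⊗ W)` with an integrable integrand
  (`stub_pairCorrProductForm`);
* §3 LOCALITY OF THE SEVERED FLOW `T^Λ_t` (`InfiniteChainSevered`): configurations agreeing on `Λ` and on the sites
  adjacent to `Λ` have the same severed evolution on `Λ` (uniqueness of severed solutions).

All statements proved; `[folklore]`. No definitions.
-/

noncomputable section

namespace Summit.AtomisticToContinuum.FouriersLaw.Theorems.AbelThermodynamicLimit.LoomisCompactHorizonWitness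

open MeasureTheory ProbabilityTheory Set Filter Topology Function
open scoped NNReal ENNReal
open Literature.MathematicalPhysics.KineticTheory Literature.MathematicalPhysics.KineticTheory.HeatConduction
open Literature.Probability.Process OscillatorChain
open Summit.AtomisticToContinuum.FouriersLaw.Theorems.NonBallistic
open Summit.AtomisticToContinuum.FouriersLaw.Theorems.SubdiffusiveBondHeat
open Summit.AtomisticToContinuum.FouriersLaw.Theorems.LightConeBondHeat (pinnedChain_abs_bondCurrent_le_exp
  quarter_inv_temp_admissible)

/-! ### §1 The centred embedding `ι_N : PhaseSpace N → ChainConfig` -/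

section Embedding

variable {N : ℕ}

/-- The centred embedding is continuous (each coordinate is a coordinate projection or a constant). [folklore] -/
theorem continuous_centredEmbedding (ι : (N : ℕ) → PhaseSpace N → ChainConfig)
    (hι : ∀ (N : ℕ) (z : PhaseSpace N) (i : ℤ), ι N z i =
      if h : 0 ≤ i + ((N - 1) / 2 : ℕ) ∧ i + ((N - 1) / 2 : ℕ) < N then
        (z.1 ⟨(i + ((N - 1) / 2 : ℕ)).toNat, by omega⟩, z.2 ⟨(i + ((N - 1) / 2 : ℕ)).toNat, by omega⟩)
      else (0, 0)) (N : ℕ) :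
    Continuous (ι N) := by
  refine continuous_pi fun i => ?_
  have e : (fun z : PhaseSpace N => ι N z i) = fun z =>
      if h : 0 ≤ i + ((N - 1) / 2 : ℕ) ∧ i + ((N - 1) / 2 : ℕ) < N then
        (z.1 ⟨(i + ((N - 1) / 2 : ℕ)).toNat, by omega⟩, z.2 ⟨(i + ((N - 1) / 2 : ℕ)).toNat, by omega⟩)
      else (0, 0) := funext fun z => hι N z i
  rw [e]
  split_ifs with h
  · fun_prop
  · exact continuous_const

/-- The centred embedding is measurable. [folklore] -/
theorem measurable_centredEmbedding (ι : (N : ℕ) → PhaseSpace N → ChainConfig)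
    (hι : ∀ (N : ℕ) (z : PhaseSpace N) (i : ℤ), ι N z i =
      if h : 0 ≤ i + ((N - 1) / 2 : ℕ) ∧ i + ((N - 1) / 2 : ℕ) < N then
        (z.1 ⟨(i + ((N - 1) / 2 : ℕ)).toNat, by omega⟩, z.2 ⟨(i + ((N - 1) / 2 : ℕ)).toNat, by omega⟩)
      else (0, 0)) (N : ℕ) :
    Measurable (ι N) :=
  (continuous_centredEmbedding ι hι N).measurable

/-- On a chain site `k` with `k = i + c_N`, the embedded configuration reads the site's coordinates. [folklore] -/
theorem centredEmbedding_apply_of_eq (ι : (N : ℕ) → PhaseSpace N → ChainConfig)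
    (hι : ∀ (N : ℕ) (z : PhaseSpace N) (i : ℤ), ι N z i =
      if h : 0 ≤ i + ((N - 1) / 2 : ℕ) ∧ i + ((N - 1) / 2 : ℕ) < N then
        (z.1 ⟨(i + ((N - 1) / 2 : ℕ)).toNat, by omega⟩, z.2 ⟨(i + ((N - 1) / 2 : ℕ)).toNat, by omega⟩)
      else (0, 0)) (z : PhaseSpace N) (i : ℤ) (k : Fin N) (hk : (k : ℤ) = i + ((N - 1) / 2 : ℕ)) :
    ι N z i = (z.1 k, z.2 k) := by
  rw [hι]
  have h : 0 ≤ i + ((N - 1) / 2 : ℕ) ∧ i + ((N - 1) / 2 : ℕ) < N := by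
    constructor <;> omega
  rw [dif_pos h]
  have hk' : (⟨(i + ((N - 1) / 2 : ℕ)).toNat, by omega⟩ : Fin N) = k := by
    ext; simp only; omega
  rw [hk']

/-- Off the chain the embedded configuration vanishes. [folklore] -/
theorem centredEmbedding_apply_of_not (ι : (N : ℕ) → PhaseSpace N → ChainConfig)
    (hι : ∀ (N : ℕ) (z : PhaseSpace N) (i : ℤ), ι N z i =
      if h : 0 ≤ i + ((N - 1) / 2 : ℕ) ∧ i + ((N - 1) / 2 : ℕ) < N then
        (z.1 ⟨(i + ((N - 1) / 2 : ℕ)).toNat, by omega⟩, z.2 ⟨(i + ((N - 1) / 2 : ℕ)).toNat, by omega⟩)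
      else (0, 0)) (z : PhaseSpace N) (i : ℤ) (h : ¬ (0 ≤ i + ((N - 1) / 2 : ℕ) ∧ i + ((N - 1) / 2 : ℕ) < N)) :
    ι N z i = (0, 0) := by
  rw [hι, dif_neg h]

/-- **The bond currents through the embedding**: for a genuine bond `k` (`k + 1 < N`) with `k = x + c_N`,
`j_k(z) = j_x(ι_N z)` (the two formulas coincide). [folklore] -/
theorem bondCurrent_eq_bondCurrentZ_centredEmbedding (P : OscillatorChain) (ι : (N : ℕ) → PhaseSpace N → ChainConfig)
    (hι : ∀ (N : ℕ) (z : PhaseSpace N) (i : ℤ), ι N z i =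
      if h : 0 ≤ i + ((N - 1) / 2 : ℕ) ∧ i + ((N - 1) / 2 : ℕ) < N then
        (z.1 ⟨(i + ((N - 1) / 2 : ℕ)).toNat, by omega⟩, z.2 ⟨(i + ((N - 1) / 2 : ℕ)).toNat, by omega⟩)
      else (0, 0)) (z : PhaseSpace N) (x : ℤ) (k : Fin N) (hk1 : k.val + 1 < N)
    (hk : (k : ℤ) = x + ((N - 1) / 2 : ℕ)) :
    P.bondCurrent N k z = P.bondCurrentZ (ι N z) x := by
  set k1 : Fin N := ⟨k.val + 1, hk1⟩ with hk1def
  have e0 : ι N z x = (z.1 k, z.2 k) := centredEmbedding_apply_of_eq ι hι z x k hk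
  have e1 : ι N z (x + 1) = (z.1 k1, z.2 k1) :=
    centredEmbedding_apply_of_eq ι hι z (x + 1) k1 (by simp [hk1def]; omega)
  rw [OscillatorChain.bondCurrentZ, e0, e1, OscillatorChain.bondCurrent]
  rw [Finset.sum_eq_single k1]
  · simp [hk1def]
  · intro j _ hj
    have : ¬ (j.val = k.val + 1) := fun h => hj (Fin.ext (by simp [hk1def, h]))
    simp [this]
  · intro h; exact absurd (Finset.mem_univ k1) h

end Embedding


/-! ### §2 Product form of the equilibrium pair correlation and the truncation bound -/

section ProductForm

variable {ω₂ lam β γ : ℝ} (hω : 0 < ω₂) (hl : 0 < lam) (hβ : 0 < β) (hγ : 0 < γ) {N : ℕ} (hN : 0 < N)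
  {T : ℝ} (hT : 0 < T)

include hω hl hβ hγ hN hT in
/-- **Stationarity of the path law, measure-preserving form**: for every real time `t` the map
`(z, ω) ↦ Φ_t(z, Bω)` pushes `μ_{N,T} ⊗ W` forward to `μ_{N,T}` (Gibbs invariance of the constructed kernels).
[folklore] -/
theorem pinnedChain_measurePreserving_solMap_prod (t : ℝ) :
    MeasurePreserving (fun q : PhaseSpace N × WienerPair =>
        (pinnedChain ω₂ lam β γ).solMap N T T t q.1 (pairPath q.2))
      (((pinnedChain ω₂ lam β γ).gibbsMeasure N T).prod wienerPair) ((pinnedChain ω₂ lam β γ).gibbsMeasure N T) := by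
  have hΦm := pinnedChain_measurable_solMap_pairPath hω hl.le hβ.le hγ.le N T T t
  refine ⟨hΦm, Measure.ext fun s hs => ?_⟩
  rw [Measure.map_apply hΦm hs, ← lintegral_indicator_one (hΦm hs), ← lintegral_indicator_one hs]
  have h := pinnedChain_lintegral_prod_solMap_gibbs hω hl.le hβ.le hγ.le N hN hT t
    (g := s.indicator (1 : PhaseSpace N → ℝ≥0∞)) (measurable_one.indicator hs)
  exact Eq.trans (lintegral_congr fun q => rfl) h

include hω hl hβ hγ hN hT in
/-- Integrability along the path at time `t` of an observable integrable under the Gibbs measure. [folklore] -/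
theorem pinnedChain_integrable_comp_solMap_prod (t : ℝ) {g : PhaseSpace N → ℝ}
    (hg : Integrable g ((pinnedChain ω₂ lam β γ).gibbsMeasure N T)) :
    Integrable (fun q : PhaseSpace N × WienerPair =>
        g ((pinnedChain ω₂ lam β γ).solMap N T T t q.1 (pairPath q.2)))
      (((pinnedChain ω₂ lam β γ).gibbsMeasure N T).prod wienerPair) :=
  ((pinnedChain_measurePreserving_solMap_prod hω hl hβ hγ hN hT t).integrable_comp hg.aestronglyMeasurable).2 hg

include hω hl hβ hγ hN hT in
/-- Stationarity, integral form on the product: `∫ g(Φ_t(z, Bω)) d(μ_T ⊗ W) = ∫ g dμ_T`. [folklore] -/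
theorem pinnedChain_integral_comp_solMap_prod (t : ℝ) {g : PhaseSpace N → ℝ}
    (hg : AEStronglyMeasurable g ((pinnedChain ω₂ lam β γ).gibbsMeasure N T)) :
    ∫ q, g ((pinnedChain ω₂ lam β γ).solMap N T T t q.1 (pairPath q.2))
        ∂(((pinnedChain ω₂ lam β γ).gibbsMeasure N T).prod wienerPair) =
      ∫ y, g y ∂((pinnedChain ω₂ lam β γ).gibbsMeasure N T) := by
  have hmp := pinnedChain_measurePreserving_solMap_prod hω hl hβ hγ hN hT t
  have hg' : AEStronglyMeasurable g (Measure.map (fun q : PhaseSpace N × WienerPair =>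
      (pinnedChain ω₂ lam β γ).solMap N T T t q.1 (pairPath q.2))
      (((pinnedChain ω₂ lam β γ).gibbsMeasure N T).prod wienerPair)) := by rw [hmp.map_eq]; exact hg
  have h := integral_map hmp.measurable.aemeasurable hg'
  rw [hmp.map_eq] at h
  exact h.symm

include hω hl hβ hγ hN hT in
/-- **Product form of the pair correlation**: for a genuine... any bonds `c, k` and `t ≥ 0`,
`∫ j_c · (κ_t j_k) dμ_T = ∫ j_c(z) j_k(Φ_t(z, Bω)) d(μ_T ⊗ W)`; the integrand is integrable. [folklore] -/
theorem pinnedChain_pairCorr_eq_integral_prod (c k : Fin N) {t : ℝ} (ht : 0 ≤ t) :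
    Integrable (fun q : PhaseSpace N × WienerPair => (pinnedChain ω₂ lam β γ).bondCurrent N c q.1 *
        (pinnedChain ω₂ lam β γ).bondCurrent N k ((pinnedChain ω₂ lam β γ).solMap N T T t q.1 (pairPath q.2)))
      (((pinnedChain ω₂ lam β γ).gibbsMeasure N T).prod wienerPair) ∧
    ∫ z, (pinnedChain ω₂ lam β γ).bondCurrent N c z *
        (∫ y, (pinnedChain ω₂ lam β γ).bondCurrent N k y
          ∂((pinnedChain ω₂ lam β γ).transitionKernel N T T t.toNNReal z))
        ∂((pinnedChain ω₂ lam β γ).gibbsMeasure N T) =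
      ∫ q, (pinnedChain ω₂ lam β γ).bondCurrent N c q.1 *
          (pinnedChain ω₂ lam β γ).bondCurrent N k ((pinnedChain ω₂ lam β γ).solMap N T T t q.1 (pairPath q.2))
        ∂(((pinnedChain ω₂ lam β γ).gibbsMeasure N T).prod wienerPair) := by
  set P := pinnedChain ω₂ lam β γ with hP
  set μ := P.gibbsMeasure N T with hμ
  haveI : IsProbabilityMeasure μ := pinnedChain_isProbabilityMeasure_gibbsMeasure hω hl.le hβ.le γ N hT
  obtain ⟨hϑ0, h2ϑ⟩ := quarter_inv_temp_admissible hT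
  have hjc2 : Integrable (fun z => P.bondCurrent N c z ^ 2) μ :=
    (pinnedChain_integral_sq_act_le hω hl.le hβ hγ hN hT hϑ0 h2ϑ (pinnedChain_continuous_bondCurrent ω₂ lam β γ N c)
      (pinnedChain_abs_bondCurrent_le_exp hω.le hl.le hβ.le γ N hϑ0 c) 0).1
  have hjk2 : Integrable (fun z => P.bondCurrent N k z ^ 2) μ :=
    (pinnedChain_integral_sq_act_le hω hl.le hβ hγ hN hT hϑ0 h2ϑ (pinnedChain_continuous_bondCurrent ω₂ lam β γ N k)
      (pinnedChain_abs_bondCurrent_le_exp hω.le hl.le hβ.le γ N hϑ0 k) 0).1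
  have hΦm := pinnedChain_measurable_solMap_pairPath hω hl.le hβ.le hγ.le N T T t
  have hjcm : Measurable (P.bondCurrent N c) := (pinnedChain_continuous_bondCurrent ω₂ lam β γ N c).measurable
  have hjkm : Measurable (P.bondCurrent N k) := (pinnedChain_continuous_bondCurrent ω₂ lam β γ N k).measurable
  -- integrability of the product integrand: `|ab| ≤ a² + b²`
  have hA : Integrable (fun q : PhaseSpace N × WienerPair => P.bondCurrent N c q.1 ^ 2) (μ.prod wienerPair) :=
    hjc2.comp_fst wienerPair
  have hB : Integrable (fun q : PhaseSpace N × WienerPair =>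
      P.bondCurrent N k (P.solMap N T T t q.1 (pairPath q.2)) ^ 2) (μ.prod wienerPair) :=
    pinnedChain_integrable_comp_solMap_prod hω hl hβ hγ hN hT t (g := fun y => P.bondCurrent N k y ^ 2) hjk2
  have hFm : AEStronglyMeasurable (fun q : PhaseSpace N × WienerPair => P.bondCurrent N c q.1 *
      P.bondCurrent N k (P.solMap N T T t q.1 (pairPath q.2))) (μ.prod wienerPair) :=
    ((hjcm.comp measurable_fst).mul (hjkm.comp hΦm)).aestronglyMeasurable
  have hint : Integrable (fun q : PhaseSpace N × WienerPair => P.bondCurrent N c q.1 *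
      P.bondCurrent N k (P.solMap N T T t q.1 (pairPath q.2))) (μ.prod wienerPair) := by
    refine (hA.add hB).mono' hFm (Eventually.of_forall fun q => ?_)
    simp only [Pi.add_apply, Real.norm_eq_abs, abs_mul]
    nlinarith [sq_nonneg (|P.bondCurrent N c q.1| - |P.bondCurrent N k (P.solMap N T T t q.1 (pairPath q.2))|),
      sq_abs (P.bondCurrent N c q.1), sq_abs (P.bondCurrent N k (P.solMap N T T t q.1 (pairPath q.2))),
      abs_nonneg (P.bondCurrent N c q.1), abs_nonneg (P.bondCurrent N k (P.solMap N T T t q.1 (pairPath q.2)))]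
  refine ⟨hint, ?_⟩
  rw [integral_prod _ hint]
  refine integral_congr_ae (Eventually.of_forall fun z => ?_)
  dsimp only
  rw [integral_const_mul]
  congr 1
  have h := pinnedChain_integral_transitionKernel hω hl.le hβ.le hγ.le N T T t.toNNReal z
    (g := P.bondCurrent N k) (pinnedChain_continuous_bondCurrent ω₂ lam β γ N k).aestronglyMeasurable
  rw [h, Real.coe_toNNReal t ht]

end ProductForm

/-! ### §3 Locality of the severed flow -/

section SeveredLocality

variable {P : OscillatorChain}

/-- The force at site `i` only reads the positions at `i - 1, i, i + 1`. [folklore] -/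
theorem force_congr_of_eq {σ σ' : ChainConfig} {i : ℤ} (h0 : σ i = σ' i) (hp : σ (i + 1) = σ' (i + 1))
    (hm : σ (i - 1) = σ' (i - 1)) : P.force σ i = P.force σ' i := by
  rw [force_eq, force_eq, h0, hp, hm]

/-- **Locality of the severed flow**: two configurations that agree on `Λ` and on the sites adjacent to `Λ` have
the same severed evolution on `Λ` (uniqueness of severed solutions: the evolution of `σ'` on `Λ`, glued to `σ` off
`Λ`, is a severed solution from `σ`). [folklore] -/
theorem severedFlow_apply_eq_of_forall_eq (hB1 : P.CondB1) (hU : ContDiff ℝ 2 P.U) (hV : ContDiff ℝ 2 P.V)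
    (Λ : Finset ℤ) {σ σ' : ChainConfig} (h : ∀ j : ℤ, (j ∈ Λ ∨ j + 1 ∈ Λ ∨ j - 1 ∈ Λ) → σ j = σ' j) (t : ℝ)
    {i : ℤ} (hi : i ∈ Λ) :
    severedFlow hB1 Λ t σ i = severedFlow hB1 Λ t σ' i := by
  classical
  set g : ℝ → ChainConfig := fun s j => if j ∈ Λ then severedFlow hB1 Λ s σ' j else σ j with hg
  have hsol' := isSeveredSolution_severedFlow hB1 Λ σ'
  have hagree : ∀ (s : ℝ) (j : ℤ), (j ∈ Λ ∨ j + 1 ∈ Λ ∨ j - 1 ∈ Λ) → g s j = severedFlow hB1 Λ s σ' j := by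
    intro s j hj
    by_cases hjΛ : j ∈ Λ
    · simp [hg, hjΛ]
    · simp only [hg, hjΛ, if_false]
      rw [severedFlow_apply_of_not_mem hB1 Λ s σ' hjΛ]
      exact h j hj
  have hgsol : P.IsSeveredSolution Λ g := by
    refine ⟨fun j hj s => ?_, fun j hj s => ?_⟩
    · have e1 : (fun s => (g s j).1) = fun s => (severedFlow hB1 Λ s σ' j).1 :=
        funext fun s => by rw [hagree s j (Or.inl hj)]
      have e2 : (fun s => (g s j).2) = fun s => (severedFlow hB1 Λ s σ' j).2 :=
        funext fun s => by rw [hagree s j (Or.inl hj)]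
      have e3 : P.force (g s) j = P.force (severedFlow hB1 Λ s σ') j :=
        force_congr_of_eq (hagree s j (Or.inl hj)) (hagree s (j + 1) (Or.inr (Or.inr (by simpa using hj))))
          (hagree s (j - 1) (Or.inr (Or.inl (by simpa using hj))))
      rw [e1, e2, e3, hagree s j (Or.inl hj)]
      exact hsol'.1 j hj s
    · simp [hg, hj]
  have hg0 : g 0 = σ := by
    funext j
    by_cases hjΛ : j ∈ Λ
    · simp only [hg, hjΛ, if_true, severedFlow_zero]
      exact (h j (Or.inl hjΛ)).symm
    · simp [hg, hjΛ]
  have key := hgsol.eq_severedFlow (hB1 := hB1) hU hV t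
  rw [hg0] at key
  have := congrFun key i
  rw [← this]
  exact hagree t i (Or.inl hi)

/-- For the interval box `{-R, …, R}`: configurations agreeing on `{-(R+1), …, R+1}` have the same severed evolution on
the box. [folklore] -/
theorem severedFlow_Icc_apply_eq_of_forall_eq (hB1 : P.CondB1) (hU : ContDiff ℝ 2 P.U) (hV : ContDiff ℝ 2 P.V)
    (R : ℕ) {σ σ' : ChainConfig} (h : ∀ j : ℤ, -((R : ℤ) + 1) ≤ j → j ≤ (R : ℤ) + 1 → σ j = σ' j) (t : ℝ)
    {i : ℤ} (hi : i ∈ Finset.Icc (-(R : ℤ)) R) :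
    severedFlow hB1 (Finset.Icc (-(R : ℤ)) R) t σ i = severedFlow hB1 (Finset.Icc (-(R : ℤ)) R) t σ' i := by
  refine severedFlow_apply_eq_of_forall_eq hB1 hU hV _ (fun j hj => h j ?_ ?_) t hi <;>
  · simp only [Finset.mem_Icc] at hj; omega

end SeveredLocality


/-- **Registered sub-goal `stub_pairCorrProductForm`** (leaf (B₀) of S4, line `loomis-compact-horizon-witness`): the
equilibrium pair correlation of bond currents of the open chain as an integral over the stationary path law
`μ_{N,T} ⊗ W`, with integrable integrand (`pinnedChain_pairCorr_eq_integral_prod`, closed form). [folklore] -/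
theorem stub_pairCorrProductForm :
    ∀ ω₂ lam β γ : ℝ, 0 < ω₂ → 0 < lam → 0 < β → 0 < γ → ∀ (N : ℕ), 0 < N → ∀ T : ℝ, 0 < T →
      ∀ (c k : Fin N) (t : ℝ), 0 ≤ t →
        MeasureTheory.Integrable (fun q : Literature.MathematicalPhysics.KineticTheory.HeatConduction.PhaseSpace N ×
            Literature.Probability.Process.WienerPair =>
          (Literature.MathematicalPhysics.KineticTheory.HeatConduction.pinnedChain ω₂ lam β γ).bondCurrent N c q.1 *
          (Literature.MathematicalPhysics.KineticTheory.HeatConduction.pinnedChain ω₂ lam β γ).bondCurrent N k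
            ((Literature.MathematicalPhysics.KineticTheory.HeatConduction.pinnedChain ω₂ lam β γ).solMap N T T t q.1
              (Literature.Probability.Process.pairPath q.2)))
          (((Literature.MathematicalPhysics.KineticTheory.HeatConduction.pinnedChain ω₂ lam β γ).gibbsMeasure N T).prod
            Literature.Probability.Process.wienerPair) ∧
        ∫ z, (Literature.MathematicalPhysics.KineticTheory.HeatConduction.pinnedChain ω₂ lam β γ).bondCurrent N c z *
            (∫ y, (Literature.MathematicalPhysics.KineticTheory.HeatConduction.pinnedChain ω₂ lam β γ).bondCurrent N k y
              ∂((Literature.MathematicalPhysics.KineticTheory.HeatConduction.pinnedChain ω₂ lam β γ).transitionKernel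
                N T T t.toNNReal z))
          ∂((Literature.MathematicalPhysics.KineticTheory.HeatConduction.pinnedChain ω₂ lam β γ).gibbsMeasure N T) =
        ∫ q, (Literature.MathematicalPhysics.KineticTheory.HeatConduction.pinnedChain ω₂ lam β γ).bondCurrent N c q.1 *
            (Literature.MathematicalPhysics.KineticTheory.HeatConduction.pinnedChain ω₂ lam β γ).bondCurrent N k
              ((Literature.MathematicalPhysics.KineticTheory.HeatConduction.pinnedChain ω₂ lam β γ).solMap N T T t q.1
                (Literature.Probability.Process.pairPath q.2))
          ∂(((Literature.MathematicalPhysics.KineticTheory.HeatConduction.pinnedChain ω₂ lam β γ).gibbsMeasure N T).prod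
            Literature.Probability.Process.wienerPair) :=
  fun _ _ _ _ hω hl hβ hγ _ hN _ hT c k _ ht => pinnedChain_pairCorr_eq_integral_prod hω hl hβ hγ hN hT c k ht

end Summit.AtomisticToContinuum.FouriersLaw.Theorems.AbelThermodynamicLimit.LoomisCompactHorizonWitness

end
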